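import Literature.Analysis.FluidPDE.SawtoothCascadeSlotDamping
import Literature.Analysis.FluidPDE.SawtoothClosureMargin
import Literature.Analysis.FluidPDE.PassiveScalarShearGradientGrowth
import HarnessLib

/-!
# Per-half-pulse `L²` gradient kinematics of classical cascade scalars

Analysis/FluidPDE support file (theorems only; no definitions, no named facts): the instantiation of
`Torus.IsClassicalScalarTransportOn.sqrt_integral_partialDeriv_sq_le_of_shear` /
`….integral_partialDeriv_sq_le_of_partialDeriv_velocity_eq_zero` (`PassiveScalarShearGradientGrowth`)
to the alternating sawtooth-shear cascade carrier `SawtoothCascade.CascadeParams.field`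
(`SawtoothCascade`). On the H half-slot `[tStart j, tStart j + tHalf j]` the field is
`rateH j t · U_j(x₁) e₀` (`field_eq_smul_single_of_mem_H`, `partialDeriv_field_of_mem_H`:
`∂₀ū = 0`, `∂₁ū = rateH · U_j′(x₁) e₀`, `|U_j′| ≤ 1`, `∫ rateH ≤ γ`), so for every classical cascade
scalar `w` (`κ ≥ 0`) on `[0, 1)` and `t` in the slot:

* `‖∂₀w(t)‖₂ ≤ ‖∂₀w(tStart j)‖₂` (streamwise derivative), and
* `‖∂₁w(t)‖₂ ≤ ‖∂₁w(tStart j)‖₂ + γ‖∂₀w(tStart j)‖₂` (cross derivative)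

— the entrywise action of the shear matrix `((1, 0), (γ, 1))` on `(‖∂₀w‖₂, ‖∂₁w‖₂)`; the V half-slot
is the transpose (indices swapped). Iterating over phases gives the polynomial (`|B(γ)|`-power)
gradient bound of block B2 of the cell ad-ideate-p2's K1loc plan, in place of the Grönwall factor
`e^{2γ}` per pulse pair.

## References

* T. M. Elgindi, K. Liss, J. C. Mattingly, *Optimal enhanced dissipation and mixing for a
  time-periodic, Lipschitz velocity field on 𝕋²*, arXiv:2304.05374, §1 and Rmk. 1.4 (the pulsed
  sawtooth shears `H_α`, `V_α`, slopes `±α`). [ElgindiLissMattingly2025]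
* J. Bedrossian, M. Coti Zelati, arXiv:1510.08098, §1–§2 (passive scalars in shear flows). [BedrossianCotiZelati2017]
-/

open MeasureTheory Set Filter
open scoped Matrix

noncomputable section

namespace Literature.Analysis.FluidPDE.SawtoothCascade

open Literature.Analysis.FunctionSpaces

namespace CascadeParams

variable (P : CascadeParams)

/-- On an H half-slot, `‖∂₁ū(t, x)‖ ≤ rateH j t` (`∂₁ū = rateH · U_j′(x₁) e₀`, `|U_j′| ≤ 1`).
[cite: ElgindiLissMattingly2025, §1 (u_α = H_α(x₂) e₁, slope ±α)] -/
theorem norm_partialDeriv_one_field_le_of_mem_H (hγ : 0 ≤ P.γ) {j : ℕ} (hδ : 0 < P.δ j) {t : ℝ}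
    (ht : t ∈ Icc (tStart j) (tStart j + tHalf j)) (x : UnitAddTorus (Fin 2)) :
    ‖Torus.partialDeriv 1 (P.field t) x‖ ≤ P.rateH j t := by
  have hn1 : ‖EuclideanSpace.single (0 : Fin 2) (1 : ℝ)‖ = 1 := by
    rw [← EuclideanSpace.basisFun_apply]
    exact (EuclideanSpace.basisFun (Fin 2) ℝ).orthonormal.1 0
  rw [(P.partialDeriv_field_of_mem_H ht x).2, norm_smul, hn1, mul_one, Real.norm_eq_abs, abs_mul,
    abs_of_nonneg (P.rateH_nonneg hγ j t)]
  calc P.rateH j t * |deriv (P.U j) (Torus.repr x 1)| ≤ P.rateH j t * 1 :=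
        mul_le_mul_of_nonneg_left (P.abs_deriv_U_le_one hδ _) (P.rateH_nonneg hγ j t)
    _ = P.rateH j t := mul_one _

/-- On a V half-slot, `‖∂₀ū(t, x)‖ ≤ rateV j t` (`∂₀ū = rateV · U_j′(x₀) e₁`, `|U_j′| ≤ 1`).
[cite: ElgindiLissMattingly2025, §1 (u_α = V_α(x₁) e₂, slope ±α)] -/
theorem norm_partialDeriv_zero_field_le_of_mem_V (hγ : 0 ≤ P.γ) {j : ℕ} (hδ : 0 < P.δ j) {t : ℝ}
    (ht : t ∈ Icc (tStart j + tHalf j) (tStart (j + 1))) (x : UnitAddTorus (Fin 2)) :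
    ‖Torus.partialDeriv 0 (P.field t) x‖ ≤ P.rateV j t := by
  have hn1 : ‖EuclideanSpace.single (1 : Fin 2) (1 : ℝ)‖ = 1 := by
    rw [← EuclideanSpace.basisFun_apply]
    exact (EuclideanSpace.basisFun (Fin 2) ℝ).orthonormal.1 1
  rw [(P.partialDeriv_field_of_mem_V ht x).2, norm_smul, hn1, mul_one, Real.norm_eq_abs, abs_mul,
    abs_of_nonneg (P.rateV_nonneg hγ j t)]
  calc P.rateV j t * |deriv (P.U j) (Torus.repr x 0)| ≤ P.rateV j t * 1 :=
        mul_le_mul_of_nonneg_left (P.abs_deriv_U_le_one hδ _) (P.rateV_nonneg hγ j t)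
    _ = P.rateV j t := mul_one _

/-- **H half-slot gradient kinematics** of a classical cascade scalar (`κ ≥ 0`, `γ ≥ 0`, `δ j > 0`):
for `t ∈ [tStart j, tStart j + tHalf j]`, the streamwise derivative does not grow,
`‖∂₀w(t)‖₂² ≤ ‖∂₀w(tStart j)‖₂²`, and the cross derivative grows at most linearly in the strain,
`‖∂₁w(t)‖₂ ≤ ‖∂₁w(tStart j)‖₂ + (∫_{tStart j}^{t} rateH j) ‖∂₀w(tStart j)‖₂ ≤ ‖∂₁w(tStart j)‖₂ + γ ‖∂₀w(tStart j)‖₂`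
(the shear matrix `((1,0),(γ,1))` acting on `(‖∂₀w‖₂, ‖∂₁w‖₂)`; no `e^{γ}`).
[cite: ElgindiLissMattingly2025, §1 and Rmk. 1.4 (H_α pulse of total strain α)] -/
theorem slotGradient_H (hγ : 0 ≤ P.γ) {j : ℕ} (hδ : 0 < P.δ j) {κ : ℝ} (hκ : 0 ≤ κ)
    {w : ℝ → UnitAddTorus (Fin 2) → ℝ} (hw : Torus.IsClassicalScalarTransportOn (Ico 0 1) κ P.field w)
    {t : ℝ} (ht : t ∈ Icc (tStart j) (tStart j + tHalf j)) :
    (∫ x, (Torus.partialDeriv 0 (w t) x) ^ 2 ≤ ∫ x, (Torus.partialDeriv 0 (w (tStart j)) x) ^ 2) ∧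
      Real.sqrt (∫ x, (Torus.partialDeriv 1 (w t) x) ^ 2) ≤
        Real.sqrt (∫ x, (Torus.partialDeriv 1 (w (tStart j)) x) ^ 2) +
          P.γ * Real.sqrt (∫ x, (Torus.partialDeriv 0 (w (tStart j)) x) ^ 2) := by
  have hI := Icc_H_subset_Ico j
  have hinv : ∀ s ∈ Icc (tStart j) (tStart j + tHalf j), ∀ x, Torus.partialDeriv 0 (P.field s) x = 0 :=
    fun s hs x => (P.partialDeriv_field_of_mem_H hs x).1
  refine ⟨hw.integral_partialDeriv_sq_le_of_partialDeriv_velocity_eq_zero hκ hI 0 hinv ht, ?_⟩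
  have h := hw.sqrt_integral_partialDeriv_sq_le_of_shear hκ hI 0 1
    (fun s hs x => P.field_eq_smul_single_of_mem_H hs x) hinv
    (fun s hs x => P.norm_partialDeriv_one_field_le_of_mem_H hγ hδ hs x)
    (P.continuous_rateH j).continuousOn ht
  refine h.trans ?_
  gcongr
  exact P.integral_rateH_le hγ ht

/-- **V half-slot gradient kinematics** (the transpose): for `t ∈ [tStart j + tHalf j, tStart (j+1)]`,
`‖∂₁w(t)‖₂² ≤ ‖∂₁w(tStart j + tHalf j)‖₂²` and
`‖∂₀w(t)‖₂ ≤ ‖∂₀w(tStart j + tHalf j)‖₂ + γ ‖∂₁w(tStart j + tHalf j)‖₂`.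
[cite: ElgindiLissMattingly2025, §1 and Rmk. 1.4 (V_α pulse of total strain α)] -/
theorem slotGradient_V (hγ : 0 ≤ P.γ) {j : ℕ} (hδ : 0 < P.δ j) {κ : ℝ} (hκ : 0 ≤ κ)
    {w : ℝ → UnitAddTorus (Fin 2) → ℝ} (hw : Torus.IsClassicalScalarTransportOn (Ico 0 1) κ P.field w)
    {t : ℝ} (ht : t ∈ Icc (tStart j + tHalf j) (tStart (j + 1))) :
    (∫ x, (Torus.partialDeriv 1 (w t) x) ^ 2 ≤ ∫ x, (Torus.partialDeriv 1 (w (tStart j + tHalf j)) x) ^ 2) ∧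
      Real.sqrt (∫ x, (Torus.partialDeriv 0 (w t) x) ^ 2) ≤
        Real.sqrt (∫ x, (Torus.partialDeriv 0 (w (tStart j + tHalf j)) x) ^ 2) +
          P.γ * Real.sqrt (∫ x, (Torus.partialDeriv 1 (w (tStart j + tHalf j)) x) ^ 2) := by
  have hI := Icc_V_subset_Ico j
  have hinv : ∀ s ∈ Icc (tStart j + tHalf j) (tStart (j + 1)), ∀ x, Torus.partialDeriv 1 (P.field s) x = 0 :=
    fun s hs x => (P.partialDeriv_field_of_mem_V hs x).1
  refine ⟨hw.integral_partialDeriv_sq_le_of_partialDeriv_velocity_eq_zero hκ hI 1 hinv ht, ?_⟩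
  have h := hw.sqrt_integral_partialDeriv_sq_le_of_shear hκ hI 1 0
    (fun s hs x => P.field_eq_smul_single_of_mem_V hs x) hinv
    (fun s hs x => P.norm_partialDeriv_zero_field_le_of_mem_V hγ hδ hs x)
    (P.continuous_rateV j).continuousOn ht
  refine h.trans ?_
  gcongr
  exact P.integral_rateV_le hγ ht

/-- **One pulse pair** (phase `j`: H half-slot then V half-slot): with
`a_j = ‖∂₀w(tStart j)‖₂`, `b_j = ‖∂₁w(tStart j)‖₂`,
`a_{j+1} ≤ (1 + γ²) a_j + γ b_j` and `b_{j+1} ≤ γ a_j + b_j` — entrywise `(a, b)_{j+1} ≤ A(1,1)(a, b)_j` with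
the nonnegative pulse-pair matrix `A(1,1) = pulseJac γ 1 1 = ((1 + γ², γ), (γ, 1))` (compose
`slotGradient_H` at `tStart j + tHalf j` with `slotGradient_V` at `tStart (j+1) = tStart j + 2 tHalf j`).
[cite: ElgindiLissMattingly2025, §1.2.2 (the pulse-pair Jacobians A(r,s)) and Rmk. 1.4] -/
theorem pulseGradient_le (hγ : 0 ≤ P.γ) (hδ : ∀ j, 0 < P.δ j) {κ : ℝ} (hκ : 0 ≤ κ)
    {w : ℝ → UnitAddTorus (Fin 2) → ℝ} (hw : Torus.IsClassicalScalarTransportOn (Ico 0 1) κ P.field w)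
    (j : ℕ) :
    Real.sqrt (∫ x, (Torus.partialDeriv 0 (w (tStart (j + 1))) x) ^ 2) ≤
        (1 + P.γ ^ 2) * Real.sqrt (∫ x, (Torus.partialDeriv 0 (w (tStart j)) x) ^ 2) +
          P.γ * Real.sqrt (∫ x, (Torus.partialDeriv 1 (w (tStart j)) x) ^ 2) ∧
      Real.sqrt (∫ x, (Torus.partialDeriv 1 (w (tStart (j + 1))) x) ^ 2) ≤
        P.γ * Real.sqrt (∫ x, (Torus.partialDeriv 0 (w (tStart j)) x) ^ 2) +
          Real.sqrt (∫ x, (Torus.partialDeriv 1 (w (tStart j)) x) ^ 2) := by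
  have hT := tHalf_pos j
  have hmidH : tStart j + tHalf j ∈ Icc (tStart j) (tStart j + tHalf j) :=
    ⟨le_add_of_nonneg_right hT.le, le_rfl⟩
  have hendV : tStart (j + 1) ∈ Icc (tStart j + tHalf j) (tStart (j + 1)) :=
    ⟨by rw [tStart_succ]; linarith, le_rfl⟩
  obtain ⟨hH0, hH1⟩ := P.slotGradient_H hγ (hδ j) hκ hw hmidH
  obtain ⟨hV1, hV0⟩ := P.slotGradient_V hγ (hδ j) hκ hw hendV
  -- abbreviations
  set a := Real.sqrt (∫ x, (Torus.partialDeriv 0 (w (tStart j)) x) ^ 2) with ha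
  set b := Real.sqrt (∫ x, (Torus.partialDeriv 1 (w (tStart j)) x) ^ 2) with hb
  set a' := Real.sqrt (∫ x, (Torus.partialDeriv 0 (w (tStart j + tHalf j)) x) ^ 2) with ha'
  set b' := Real.sqrt (∫ x, (Torus.partialDeriv 1 (w (tStart j + tHalf j)) x) ^ 2) with hb'
  have ha'le : a' ≤ a := Real.sqrt_le_sqrt hH0
  have hb1le : Real.sqrt (∫ x, (Torus.partialDeriv 1 (w (tStart (j + 1))) x) ^ 2) ≤ b' :=
    Real.sqrt_le_sqrt hV1
  have hγa : P.γ * b' ≤ P.γ * (b + P.γ * a) := mul_le_mul_of_nonneg_left hH1 hγ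
  constructor
  · calc Real.sqrt (∫ x, (Torus.partialDeriv 0 (w (tStart (j + 1))) x) ^ 2) ≤ a' + P.γ * b' := hV0
      _ ≤ a + P.γ * (b + P.γ * a) := add_le_add ha'le hγa
      _ = (1 + P.γ ^ 2) * a + P.γ * b := by ring
  · calc Real.sqrt (∫ x, (Torus.partialDeriv 1 (w (tStart (j + 1))) x) ^ 2) ≤ b' := hb1le
      _ ≤ b + P.γ * a := hH1
      _ = P.γ * a + b := by ring

/-- **`n` pulse pairs**: entrywise `(a, b)_{j+n} ≤ A(1,1)^n (a, b)_j`, i.e. with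
`v = pulseJac γ 1 1 ^ n *ᵥ ![‖∂₀w(tStart j)‖₂, ‖∂₁w(tStart j)‖₂]`:
`‖∂₀w(tStart (j+n))‖₂ ≤ v₀` and `‖∂₁w(tStart (j+n))‖₂ ≤ v₁` (induction; `A(1,1)` has nonnegative
entries, hence is monotone on the nonnegative quadrant) — the polynomial (`‖A(1,1)‖^n`) gradient
bound of the cascade over `n` phases, in place of the Grönwall factor `e^{2γn}`.
[cite: ElgindiLissMattingly2025, §1.2.2 (∇T^N = Π A_{jᵢ}) and Rmk. 1.4] -/
theorem iterate_pulseGradient_le (hγ : 0 ≤ P.γ) (hδ : ∀ j, 0 < P.δ j) {κ : ℝ} (hκ : 0 ≤ κ)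
    {w : ℝ → UnitAddTorus (Fin 2) → ℝ} (hw : Torus.IsClassicalScalarTransportOn (Ico 0 1) κ P.field w)
    (j n : ℕ) :
    Real.sqrt (∫ x, (Torus.partialDeriv 0 (w (tStart (j + n))) x) ^ 2) ≤
        (pulseJac P.γ 1 1 ^ n *ᵥ ![Real.sqrt (∫ x, (Torus.partialDeriv 0 (w (tStart j)) x) ^ 2),
          Real.sqrt (∫ x, (Torus.partialDeriv 1 (w (tStart j)) x) ^ 2)]) 0 ∧
      Real.sqrt (∫ x, (Torus.partialDeriv 1 (w (tStart (j + n))) x) ^ 2) ≤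
        (pulseJac P.γ 1 1 ^ n *ᵥ ![Real.sqrt (∫ x, (Torus.partialDeriv 0 (w (tStart j)) x) ^ 2),
          Real.sqrt (∫ x, (Torus.partialDeriv 1 (w (tStart j)) x) ^ 2)]) 1 := by
  induction n with
  | zero => simp
  | succ n ih =>
    obtain ⟨ih0, ih1⟩ := ih
    set v := pulseJac P.γ 1 1 ^ n *ᵥ ![Real.sqrt (∫ x, (Torus.partialDeriv 0 (w (tStart j)) x) ^ 2),
      Real.sqrt (∫ x, (Torus.partialDeriv 1 (w (tStart j)) x) ^ 2)] with hv
    have hstep := P.pulseGradient_le hγ hδ hκ hw (j + n)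
    rw [show j + (n + 1) = j + n + 1 by ring]
    have hpow : pulseJac P.γ 1 1 ^ (n + 1) *ᵥ
        ![Real.sqrt (∫ x, (Torus.partialDeriv 0 (w (tStart j)) x) ^ 2),
          Real.sqrt (∫ x, (Torus.partialDeriv 1 (w (tStart j)) x) ^ 2)] = pulseJac P.γ 1 1 *ᵥ v := by
      rw [pow_succ', ← Matrix.mulVec_mulVec]
    rw [hpow, pulseJac_mulVec]
    simp only [one_mul, Matrix.cons_val_zero, Matrix.cons_val_one]
    have hv0 : 0 ≤ v 0 := (Real.sqrt_nonneg _).trans ih0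
    constructor
    · calc Real.sqrt (∫ x, (Torus.partialDeriv 0 (w (tStart (j + n + 1))) x) ^ 2)
          ≤ (1 + P.γ ^ 2) * Real.sqrt (∫ x, (Torus.partialDeriv 0 (w (tStart (j + n))) x) ^ 2) +
            P.γ * Real.sqrt (∫ x, (Torus.partialDeriv 1 (w (tStart (j + n))) x) ^ 2) := hstep.1
        _ ≤ (1 + P.γ ^ 2) * v 0 + P.γ * v 1 := by
            gcongr
    · calc Real.sqrt (∫ x, (Torus.partialDeriv 1 (w (tStart (j + n + 1))) x) ^ 2)
          ≤ P.γ * Real.sqrt (∫ x, (Torus.partialDeriv 0 (w (tStart (j + n))) x) ^ 2) +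
            Real.sqrt (∫ x, (Torus.partialDeriv 1 (w (tStart (j + n))) x) ^ 2) := hstep.2
        _ ≤ P.γ * v 0 + v 1 := by
            gcongr

/-- Powers of the symmetric pulse-pair Jacobian are bounded in the Euclidean norm by powers of the
envelope: `‖A(1,1)ⁿ v‖² ≤ ‖B(γ)‖^{2n} ‖v‖²` (`pulseJac_mulVec_sq_add_sq_le`, induction). [folklore] -/
private theorem pulseJac_pow_mulVec_sq_add_sq_le {γ : ℝ} (hγ : 0 < γ) (v : Fin 2 → ℝ) (n : ℕ) :
    (pulseJac γ 1 1 ^ n *ᵥ v) 0 ^ 2 + (pulseJac γ 1 1 ^ n *ᵥ v) 1 ^ 2 ≤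
      ((((γ ^ 2 + 2) + Real.sqrt ((γ ^ 2 + 2) ^ 2 - 4)) / 2) ^ 2) ^ n * (v 0 ^ 2 + v 1 ^ 2) := by
  induction n with
  | zero => simp
  | succ n ih =>
    rw [show pulseJac γ 1 1 ^ (n + 1) = pulseJac γ 1 1 * pulseJac γ 1 1 ^ n from pow_succ' _ _,
      ← Matrix.mulVec_mulVec]
    have h1 := pulseJac_mulVec_sq_add_sq_le hγ (Or.inl rfl) (Or.inl rfl) (pulseJac γ 1 1 ^ n *ᵥ v)
    have hE2 : 0 ≤ (((γ ^ 2 + 2) + Real.sqrt ((γ ^ 2 + 2) ^ 2 - 4)) / 2) ^ 2 := sq_nonneg _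
    calc (pulseJac γ 1 1 *ᵥ (pulseJac γ 1 1 ^ n *ᵥ v)) 0 ^ 2 +
          (pulseJac γ 1 1 *ᵥ (pulseJac γ 1 1 ^ n *ᵥ v)) 1 ^ 2
        ≤ (((γ ^ 2 + 2) + Real.sqrt ((γ ^ 2 + 2) ^ 2 - 4)) / 2) ^ 2 *
            ((pulseJac γ 1 1 ^ n *ᵥ v) 0 ^ 2 + (pulseJac γ 1 1 ^ n *ᵥ v) 1 ^ 2) := h1
      _ ≤ (((γ ^ 2 + 2) + Real.sqrt ((γ ^ 2 + 2) ^ 2 - 4)) / 2) ^ 2 *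
            (((((γ ^ 2 + 2) + Real.sqrt ((γ ^ 2 + 2) ^ 2 - 4)) / 2) ^ 2) ^ n * (v 0 ^ 2 + v 1 ^ 2)) :=
          mul_le_mul_of_nonneg_left ih hE2
      _ = ((((γ ^ 2 + 2) + Real.sqrt ((γ ^ 2 + 2) ^ 2 - 4)) / 2) ^ 2) ^ (n + 1) * (v 0 ^ 2 + v 1 ^ 2) := by
          ring

/-- **The polynomial gradient bound in operator-norm form**: for `γ > 0`, every classical cascade scalar
`w` (`κ ≥ 0`) and all phases `j`, `n`,
`‖∇w(tStart (j+n))‖₂² ≤ ‖B(γ)‖^{2n} ‖∇w(tStart j)‖₂²` with `‖B(γ)‖ = ((γ²+2) + √((γ²+2)²−4))/2` the top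
eigenvalue of `A(1,1)` (`iterate_pulseGradient_le` + `pulseJac_mulVec_sq_add_sq_le`; `‖∇w‖₂² = ‖∂₀w‖₂² + ‖∂₁w‖₂²`)
— versus the Grönwall factor `e^{2γn}` (at `γ = 5`: `‖B‖ = 26.96` per pulse pair instead of `e^{10} ≈ 22026`).
[cite: ElgindiLissMattingly2025, §1.2.2 (eigenvalue c_α of A_i; ∇T^N = Π A_{jᵢ}) and Rmk. 1.4] -/
theorem scalarGradNormSq_iterate_le (hγ : 0 < P.γ) (hδ : ∀ j, 0 < P.δ j) {κ : ℝ} (hκ : 0 ≤ κ)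
    {w : ℝ → UnitAddTorus (Fin 2) → ℝ} (hw : Torus.IsClassicalScalarTransportOn (Ico 0 1) κ P.field w)
    (j n : ℕ) :
    Torus.scalarGradNormSq (w (tStart (j + n))) ≤
      ((((P.γ ^ 2 + 2) + Real.sqrt ((P.γ ^ 2 + 2) ^ 2 - 4)) / 2) ^ 2) ^ n *
        Torus.scalarGradNormSq (w (tStart j)) := by
  have hmem : ∀ i, tStart i ∈ Ico (0 : ℝ) 1 := fun i => ⟨tStart_nonneg i, tStart_lt_one i⟩
  have hsm : ∀ i, Torus.IsSmooth (w (tStart i)) := fun i => hw.smooth_scalar.isSmooth_slice (hmem i)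
  have hsplit : ∀ i, Torus.scalarGradNormSq (w (tStart i)) =
      (∫ x, (Torus.partialDeriv 0 (w (tStart i)) x) ^ 2) + ∫ x, (Torus.partialDeriv 1 (w (tStart i)) x) ^ 2 := by
    intro i
    rw [Torus.scalarGradNormSq_eq_sum_integral (hsm i), Fin.sum_univ_two]
  obtain ⟨h0, h1⟩ := P.iterate_pulseGradient_le hγ.le hδ hκ hw j n
  set a := Real.sqrt (∫ x, (Torus.partialDeriv 0 (w (tStart j)) x) ^ 2) with ha
  set b := Real.sqrt (∫ x, (Torus.partialDeriv 1 (w (tStart j)) x) ^ 2) with hb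
  set v : Fin 2 → ℝ := ![a, b] with hv
  have hI0 : ∀ i k, 0 ≤ ∫ x, (Torus.partialDeriv k (w (tStart i)) x) ^ 2 :=
    fun i k => integral_nonneg fun x => sq_nonneg _
  have hsq0 : (∫ x, (Torus.partialDeriv 0 (w (tStart (j + n))) x) ^ 2) ≤ ((pulseJac P.γ 1 1 ^ n *ᵥ v) 0) ^ 2 := by
    have h := pow_le_pow_left₀ (Real.sqrt_nonneg _) h0 2
    rwa [Real.sq_sqrt (hI0 _ _)] at h
  have hsq1 : (∫ x, (Torus.partialDeriv 1 (w (tStart (j + n))) x) ^ 2) ≤ ((pulseJac P.γ 1 1 ^ n *ᵥ v) 1) ^ 2 := by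
    have h := pow_le_pow_left₀ (Real.sqrt_nonneg _) h1 2
    rwa [Real.sq_sqrt (hI0 _ _)] at h
  have hpow := pulseJac_pow_mulVec_sq_add_sq_le hγ v n
  have hv0 : v 0 ^ 2 = ∫ x, (Torus.partialDeriv 0 (w (tStart j)) x) ^ 2 := by
    simp only [hv, Matrix.cons_val_zero]
    exact Real.sq_sqrt (hI0 _ _)
  have hv1 : v 1 ^ 2 = ∫ x, (Torus.partialDeriv 1 (w (tStart j)) x) ^ 2 := by
    simp only [hv, Matrix.cons_val_one, Matrix.cons_val_zero]
    exact Real.sq_sqrt (hI0 _ _)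
  rw [hsplit (j + n), hsplit j, ← hv0, ← hv1]
  linarith

end CascadeParams

end Literature.Analysis.FluidPDE.SawtoothCascade

end
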